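import Mathlib
import Summits.Ventures.PercRepro2.HCov
import Summits.Ventures.PercRepro2.PocketTransport
import Summits.Ventures.PercRepro2.SameClusterAvoid
import Summits.Ventures.PercRepro2.BHKAvoid
import Summits.Ventures.PercRepro2.RootLeafUPocketGraph

/-!
# The pocket part as a percolation of its own: transport of the classical facts to the pocket copy
(blind cell PercRepro2, p4 g19; S3 (G4-u), proofs/P4-G19-OUTSIDE.md §7; no definitions)

`inn ω` is the pocket part of a configuration (the pocket edges as in `ω`, every other edge closed;
RootLeafUPocketGraph's characterisation `hinn`).  Its law under the product weights `p` is the product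
law with the non-pocket weights set to `0` (`prob_inn_eq`, by `PocketConn.prob_restrict_compl_eq`), so
every inequality of the tree holds for the pocket copy: Harris for two increasing / two decreasing / a
decreasing and an increasing event of the pocket (`harris_inn_upper`, `harris_inn_lower`,
`harris_inn_mixed`), BHK06 Thm 1.3 with set avoidance for the pocket cluster of a vertex
(`bhk_same_cluster_inn`) and BHK06 Thm 1.4 with set avoidance across two pocket clusters
(`bhk_cross_cluster_inn`).  These are the facts behind the eleven pocket inequalities of the paper's §5.1.
-/

namespace Summit.Ventures.PercRepro2

open UnionCluster CovForm

namespace RootLeafU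

namespace PocketFacts

variable {V : Type*} {E : Type*} [Fintype E] [DecidableEq E] [Fintype V] [DecidableEq V]
  {R : Type*} [Field R] [LinearOrder R] [IsStrictOrderedRing R] (p : E → R)
variable {ends : E → Sym2 V} {P : Set V} {inn : Config E → Config E}

omit [Fintype E] [DecidableEq E] [Fintype V] [DecidableEq V] [LinearOrder R] [IsStrictOrderedRing R] in
/-- The pocket part is the restriction to the pocket edges. -/
lemma inn_eq_restrict [DecidablePred (· ∈ touches ends P)]
    (hinn : (∀ ω e, e ∈ touches ends P → inn ω e = ω e) ∧ (∀ ω e, e ∉ touches ends P → inn ω e = false))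
    (ω : Config E) : inn ω = restrict (touches ends P) ω := by
  funext e
  by_cases he : e ∈ touches ends P
  · rw [hinn.1 ω e he]
    simp [restrict, he]
  · rw [hinn.2 ω e he]
    simp [restrict, he]

omit [LinearOrder R] [IsStrictOrderedRing R] in
/-- **Transport**: the law of the pocket part is the product law with the non-pocket weights set to `0`. -/
theorem prob_inn_eq
    (hinn : (∀ ω e, e ∈ touches ends P → inn ω e = ω e) ∧ (∀ ω e, e ∉ touches ends P → inn ω e = false))
    (Z : Set (Config E)) :
    prob p {ω : Config E | inn ω ∈ Z} =
      prob (PocketConn.zeroOn (by classical exact (touches ends P)ᶜ.toFinset) p) Z := by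
  classical
  have h := PocketConn.prob_restrict_compl_eq (touches ends P)ᶜ p (· ∈ Z)
  have h' : prob p {ω : Config E | inn ω ∈ Z} =
      prob p {ω : Config E | restrict (touches ends P)ᶜᶜ ω ∈ Z} := by
    congr 1
    ext ω
    simp only [Set.mem_setOf_eq, inn_eq_restrict hinn]
    have : restrict (touches ends P) ω = restrict (touches ends P)ᶜᶜ ω := by
      funext e
      by_cases he : e ∈ touches ends P
      · rw [restrict_apply_of_mem he, restrict_apply_of_mem (by simpa using he)]
      · rw [restrict_apply_of_notMem he, restrict_apply_of_notMem (by simpa using he)]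
    rw [this]
  exact h'.trans h

variable (hp : IsProbVec p)
  (hinn : (∀ ω e, e ∈ touches ends P → inn ω e = ω e) ∧ (∀ ω e, e ∉ touches ends P → inn ω e = false))
include hp hinn

/-- Harris for two increasing events of the pocket. -/
theorem harris_inn_upper {A B : Set (Config E)} (hA : IsUpperSet A) (hB : IsUpperSet B) :
    prob p {ω : Config E | inn ω ∈ A} * prob p {ω : Config E | inn ω ∈ B} ≤
      prob p {ω : Config E | inn ω ∈ A ∩ B} := by
  classical
  rw [prob_inn_eq p hinn, prob_inn_eq p hinn, prob_inn_eq p hinn]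
  exact prob_mul_prob_le_prob_inter (PocketConn.IsProbVec.zeroOn hp _) hA hB

/-- Harris for two decreasing events of the pocket. -/
theorem harris_inn_lower {A B : Set (Config E)} (hA : IsLowerSet A) (hB : IsLowerSet B) :
    prob p {ω : Config E | inn ω ∈ A} * prob p {ω : Config E | inn ω ∈ B} ≤
      prob p {ω : Config E | inn ω ∈ A ∩ B} := by
  classical
  rw [prob_inn_eq p hinn, prob_inn_eq p hinn, prob_inn_eq p hinn]
  exact prob_mul_prob_le_prob_inter_of_isLowerSet (PocketConn.IsProbVec.zeroOn hp _) hA hB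

/-- Harris, mixed: a decreasing and an increasing event of the pocket are negatively correlated. -/
theorem harris_inn_mixed {A B : Set (Config E)} (hA : IsLowerSet A) (hB : IsUpperSet B) :
    prob p {ω : Config E | inn ω ∈ A ∩ B} ≤
      prob p {ω : Config E | inn ω ∈ A} * prob p {ω : Config E | inn ω ∈ B} := by
  classical
  rw [prob_inn_eq p hinn, prob_inn_eq p hinn, prob_inn_eq p hinn]
  exact prob_inter_le_prob_mul_prob_of_isLowerSet (PocketConn.IsProbVec.zeroOn hp _) hA hB

/-- BHK06 Thm 1.3 with set avoidance for the pocket cluster of `s`: two increasing events of the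
cluster are positively correlated given that it avoids `X`. -/
theorem bhk_same_cluster_inn (s : V) (X : Finset V) {𝓤 𝓥 : Set (Set V)} (h𝓤 : IsUpperSet 𝓤)
    (h𝓥 : IsUpperSet 𝓥) :
    prob p {ω : Config E | inn ω ∈ clusterInEvent ends s 𝓤 ∩ avoidAll ends s X} *
        prob p {ω : Config E | inn ω ∈ clusterInEvent ends s 𝓥 ∩ avoidAll ends s X} ≤
      prob p {ω : Config E | inn ω ∈ clusterInEvent ends s (𝓤 ∩ 𝓥) ∩ avoidAll ends s X} *
        prob p {ω : Config E | inn ω ∈ avoidAll ends s X} := by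
  classical
  rw [prob_inn_eq p hinn, prob_inn_eq p hinn, prob_inn_eq p hinn, prob_inn_eq p hinn]
  exact bhk_same_cluster_events_avoid _ (PocketConn.IsProbVec.zeroOn hp _) ends s X h𝓤 h𝓥

/-- BHK06 Thm 1.4 with set avoidance across two pocket clusters: an increasing event of the cluster of
`s` and an increasing event of the cluster of `t ∈ X` are negatively correlated given that the cluster
of `s` avoids `X`. -/
theorem bhk_cross_cluster_inn (s t : V) {X : Finset V} (ht : t ∈ X) {𝓤 𝓥 : Set (Set V)}
    (h𝓤 : IsUpperSet 𝓤) (h𝓥 : IsUpperSet 𝓥) :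
    prob p {ω : Config E | inn ω ∈ clusterInEvent ends s 𝓤 ∩ clusterInEvent ends t 𝓥 ∩ avoidAll ends s X} *
        prob p {ω : Config E | inn ω ∈ avoidAll ends s X} ≤
      prob p {ω : Config E | inn ω ∈ clusterInEvent ends s 𝓤 ∩ avoidAll ends s X} *
        prob p {ω : Config E | inn ω ∈ clusterInEvent ends t 𝓥 ∩ avoidAll ends s X} := by
  classical
  rw [prob_inn_eq p hinn, prob_inn_eq p hinn, prob_inn_eq p hinn, prob_inn_eq p hinn]
  exact bhk_cross_cluster_avoid _ (PocketConn.IsProbVec.zeroOn hp _) ends s t ht h𝓤 h𝓥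

end PocketFacts

end RootLeafU

end Summit.Ventures.PercRepro2
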